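import Literature.AlgebraicGeometry.Frobenioids.ModelFrobenioidTypeBridge
import Literature.AlgebraicGeometry.Frobenioids.ModelFrobenioidIsFrobenioid
import Literature.AlgebraicGeometry.Frobenioids.IsoSubanchorNotIsotropic
import HarnessLib

/-!
# Frobenioids I, Theorem 5.2 (iii), first sentence — PROOF

Mochizuki, *The geometry of Frobenioids I: the general theory*, Kyushu J. Math. **62** (2008)
293–400, §5, Theorem 5.2 (iii), kurims text p. 101, proof pp. 102–103
[cite: MochizukiFrdI2008, Thm. 5.2(iii) p.101]:

  "(iii) `C` is of standard type if and only if the following conditions are satisfied: (a) if `Φ`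
  is the zero monoid, then `C` admits a Frobenius-compact object; (b) `D` is of FSMFF-type; (c) `Φ`
  is non-dilating."

This file DISCHARGES the named statement `ModelFrobenioid.StandardTypeIff Φ B DivB` of
`ModelFrobenioidStandard.lean` (seat abc-iut-L1-t2): `standardTypeIff_holds`.  As in the printed
proof (p. 102: "it is immediate from the simple structure of `F_Φ`-model Frobenioids that every
object is isotropic, Frobenius-isotropic and Frobenius-normalized"), the clauses of *standard type*
(Def. 3.1 (i): (a) quasi-isotropic and Frobenius-isotropic type, (b) a Frobenius-compact isotropic
object if of group-like type, (c) Frobenius-normalized type, (d) `D` of FSMFF-type, (e) `Φ`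
non-dilating) other than (b), (d), (e) hold automatically for a model Frobenioid:
* every object is isotropic (Thm. 5.2 (ii), seat abc-iut-found's `ModelFrobenioid.isIsotropic`),
  hence — an iso-subanchor of a Frobenioid is never isotropic (Rem. 3.1.1, `remark311_holds`) — `C`
  is of quasi-isotropic type (`isOfQuasiIsotropicType_of_isOfIsotropicType`);
* identities are of Frobenius type (every morphism of a model Frobenioid is co-angular,
  `ModelFrobenioid.isCoAngular`), so every object is Frobenius-isotropic;
* every object is Frobenius-normalized (`ModelFrobenioid.isFrobeniusNormalized`);
* "`C` is of group-like type" (every `Φ(A) = 0`, Def. 1.2 (iv)) is "`Φ` is the zero monoid", since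
  every `A_D ∈ Ob(D)` is the base of the object `(A_D, 0)`.
The two renderings of "non-dilating" (`IsNonDilatingOn Φ` of `ElementaryFrobenioid.lean` and seat
abc-iut-L1-t3's `PreFrobenioidData.IsNonDilatingOn`) agree definitionally up to function
extensionality (`data_isNonDilatingOn_iff`).  The transported object-level facts live in
`ModelFrobenioidTypeBridge.lean`; this file adds quasi-isotropy (which needs the Frobenioid axioms,
seat abc-iut-found's `ModelFrobenioid.isFrobenioid`) and assembles the `iff`.
-/


namespace Literature.AlgebraicGeometry.Frobenioids

open CategoryTheory Opposite

universe w v u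

namespace ModelFrobenioid

variable {D : Type u} [Category.{v} D] {Φ B : Dᵒᵖ ⥤ CommMonCat.{w}} {DivB : B ⟶ monoidGp Φ}

/-- A model Frobenioid (under the hypotheses of Thm. 5.2) is of quasi-isotropic type: it is of
isotropic type, and an iso-subanchor of a Frobenioid is never isotropic (Rem. 3.1.1).
[cite: MochizukiFrdI2008, Thm. 5.2(iii) p.102] -/
theorem data_isOfQuasiIsotropicType (h : Hypotheses Φ B) :
    (data Φ B DivB).IsOfQuasiIsotropicType :=
  isOfQuasiIsotropicType_of_isOfIsotropicType Φ (toElem Φ B DivB)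
    (isFrobenioid h.isMonoidOn h.isDivisorial h.isMonoidOn_rat h.isGroupLike_rat
      h.isGraphConnected h.isTotallyEpimorphic)
    (data_isOfIsotropicType h.isGroupLike_rat)

variable (Φ B DivB)

/-- **Thm. 5.2 (iii)**, first sentence — DISCHARGED: the model Frobenioid of `(Φ, B, Div_B)` is
of standard type iff (a) if `Φ` is the zero monoid then it admits a Frobenius-compact object,
(b) `D` is of FSMFF-type, (c) `Φ` is non-dilating. [cite: MochizukiFrdI2008, Thm. 5.2(iii) p.101] -/
theorem standardTypeIff_holds : StandardTypeIff Φ B DivB := by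
  intro h
  constructor
  · intro hs
    refine ⟨fun h0 => ?_, hs.fsmff, (data_isNonDilatingOn_iff Φ B DivB).mp hs.nonDilating⟩
    obtain ⟨A, -, hA⟩ :=
      hs.frobeniusCompact_of_groupLike ((data_isOfGroupLikeType_iff Φ B DivB).mpr h0)
    exact ⟨A, hA⟩
  · rintro ⟨ha, hb, hc⟩
    exact
      { quasiIsotropic := data_isOfQuasiIsotropicType h
        frobeniusIsotropic := data_isOfFrobeniusIsotropicType h.isGroupLike_rat
        frobeniusCompact_of_groupLike := fun hg => by
          obtain ⟨X, hX⟩ := ha ((data_isOfGroupLikeType_iff Φ B DivB).mp hg)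
          exact ⟨X, (data_isOfIsotropicType h.isGroupLike_rat).obj X, hX⟩
        frobeniusNormalized := data_isOfFrobeniusNormalizedType
        fsmff := hb
        nonDilating := (data_isNonDilatingOn_iff Φ B DivB).mpr hc }

/-- `StandardTypeIff` — `_holds` alias of `standardTypeIff_holds` above under the fact's exact name (appended
2026-08-28, D-0026 bookkeeping: the proof term is the existing theorem of this file; no statement,
definition or attribute is edited; no new named fact; the ledger's debt table listed the fact
unproved). [cite: MochizukiFrdI2008, Thm. 5.2(iii) p.101] -/
theorem _root_.Literature.AlgebraicGeometry.Frobenioids.ModelFrobenioid.StandardTypeIff_holds :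
    StandardTypeIff Φ B DivB :=
  _root_.Literature.AlgebraicGeometry.Frobenioids.ModelFrobenioid.standardTypeIff_holds (Φ := Φ) (B := B) (DivB := DivB)

end ModelFrobenioid

end Literature.AlgebraicGeometry.Frobenioids
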